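import Mathlib
import HarnessLib
import Summits.NavierStokesRegularity.NavierStokesRegularity.Theorems.UnthreadedDoorCellFluxDefs
import Summits.NavierStokesRegularity.NavierStokesRegularity.Theorems.UnthreadedDoorNetFluxOscLeVorticity

/-!
# Route `UnthreadedDoor`, crux `PoloidalLiouville` (stmt-NavierStokesRegularity-1222), WALL W1 — crux idea «cell-flux» (ns-idea-14,
# `Cruxes/PoloidalLiouville/CellFluxSketch.lean`): support stub Σ-0a `ClusterFluxLeVorticity`, PROVED (by name)

`CellFlux.clusterFluxLeVorticity : CellFlux.ClusterFluxLeVorticity` (the Theorems-side Defs twin p692073, body = sketch verbatim): on a cluster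
partition `𝒦` of `S_r(x₀) ∖ Γ` with `n = 𝒦.ncard` classes, the cluster flux `r · Σ_{K ∈ 𝒦} osc_K f` is `≤ n · π r · K` whenever
`curl u = ∇f × (x − x₀)` with `‖curl u‖ ≤ K` on the sphere.  PROOF: every class is a nonempty subset of the sphere, so `osc_K f ≤ osc_{S_r} f`
(`f` is continuous on the compact sphere, hence its image is bounded), and `osc_{S_r} f ≤ π K` is the landed NF-0 `NetFlux.oscLeVorticity` (p660776,
great-circle arcs); sum over the finitely many classes.  In the sketch: `theorem stub_clusterFluxLeVorticity : ClusterFluxLeVorticity :=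
Theorems.PoloidalLiouville.CellFlux.clusterFluxLeVorticity`.

HONEST LABEL: one S− support stub of the cell-flux chain; K3^Σ, Σ-1…Σ-5, `PoloidalLiouville` (1222), W1 and the summit stay OPEN; NO Navier–Stokes
regularity statement is proved.  `--supports stmt-NavierStokesRegularity-1222 --as helper`.  [folklore]
-/

noncomputable section

-- the summit and its single sub-problem share the name (CONVENTIONS §1)
set_option linter.dupNamespace false

open Set Function Filter Topology InnerProductSpace
open scoped RealInnerProductSpace

namespace Summit.NavierStokesRegularity.NavierStokesRegularity.Theorems.PoloidalLiouville.CellFlux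

open Literature.Analysis Literature.Analysis.FluidPDE
open Summit.NavierStokesRegularity.NavierStokesRegularity.Theorems.PoloidalLiouville.NetFlux (E3)

/-- The oscillation of `f` on a nonempty subset of a set with bounded image is at most the oscillation on the larger set. [folklore] -/
theorem setOsc_mono {f : E3 → ℝ} {K S : Set E3} (hKS : K ⊆ S) (hK : K.Nonempty)
    (hA : BddAbove (f '' S)) (hB : BddBelow (f '' S)) :
    setOsc f K ≤ sSup (f '' S) - sInf (f '' S) := by
  have himg : f '' K ⊆ f '' S := image_mono hKS
  have hne : (f '' K).Nonempty := hK.image f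
  have h1 : sSup (f '' K) ≤ sSup (f '' S) := csSup_le_csSup hA hne himg
  have h2 : sInf (f '' S) ≤ sInf (f '' K) := csInf_le_csInf hB hne himg
  unfold setOsc
  linarith

/-- **Σ-0a `ClusterFluxLeVorticity`** (cell-flux support stub, statement = `CellFlux.ClusterFluxLeVorticity` by name): on a cluster partition with
`n` classes, `clusterFlux f r 𝒦 ≤ n · (π r K)` when `curl u = ∇f × (x − x₀)` and `‖curl u‖ ≤ K` on `S_r(x₀)`. [folklore] -/
theorem clusterFluxLeVorticity : ClusterFluxLeVorticity := by
  intro u x₀ f r K 𝒦 hr hu hf hcurl hK hpart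
  obtain ⟨hfin, hcls, hcover, _hdisj⟩ := hpart
  -- NF-0 on the whole sphere
  have hosc : sSup (f '' Metric.sphere x₀ r) - sInf (f '' Metric.sphere x₀ r) ≤ Real.pi * K :=
    NetFlux.oscLeVorticity u x₀ f r K hr hu hf hcurl hK
  -- the image of the sphere is bounded
  have hsph : Metric.sphere x₀ r ⊆ ({x₀}ᶜ : Set E3) := fun x hx => Metric.ne_of_mem_sphere hx hr.ne'
  have hcont : ContinuousOn f (Metric.sphere x₀ r) := hf.continuousOn.mono hsph
  have hcpt : IsCompact (f '' Metric.sphere x₀ r) := (isCompact_sphere x₀ r).image_of_continuousOn hcont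
  -- every class is a nonempty subset of the sphere
  have hle : ∀ K' ∈ 𝒦, setOsc f K' ≤ Real.pi * K := by
    intro K' hK'
    have hsub : K' ⊆ Metric.sphere x₀ r := fun x hx => by
      have h : x ∈ ⋃₀ 𝒦 := mem_sUnion_of_mem hx hK'
      rw [hcover] at h
      exact h.1
    exact (setOsc_mono hsub (hcls K' hK').1 hcpt.bddAbove hcpt.bddBelow).trans hosc
  -- sum over the finitely many classes
  have hsum : ∑ᶠ K' ∈ 𝒦, setOsc f K' ≤ (𝒦.ncard : ℝ) * (Real.pi * K) := by
    rw [finsum_mem_eq_finite_toFinset_sum _ hfin, Set.ncard_eq_toFinset_card 𝒦 hfin]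
    have h := Finset.sum_le_card_nsmul hfin.toFinset (fun K' => setOsc f K') (Real.pi * K)
      (fun K' hK' => hle K' (hfin.mem_toFinset.1 hK'))
    rwa [nsmul_eq_mul] at h
  unfold clusterFlux
  calc r * ∑ᶠ K' ∈ 𝒦, setOsc f K' ≤ r * ((𝒦.ncard : ℝ) * (Real.pi * K)) :=
        mul_le_mul_of_nonneg_left hsum hr.le
    _ = (𝒦.ncard : ℝ) * (Real.pi * r * K) := by ring

end Summit.NavierStokesRegularity.NavierStokesRegularity.Theorems.PoloidalLiouville.CellFlux

end
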